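import Summits.ResolutionOfSingularities.ResolutionOfSingularities.Theorems.PurelyInseparableDim4ResConeCornerTransport
import Literature.AlgebraicGeometry.Resolution.CentreBlowupOrdAlongBasics
import HarnessLib

/-!
# Purely inseparable four-folds — C∞ PINNING, contact half: a step that keeps the order cannot translate the
# contact letter (K24b-FRAME, file F1 part (VT-f): cell `res-dim4-pi`, K2(p) lane, slice B)

[OURS · counted 0 · cell `res-dim4-pi` · K2(p) lane holder res-dim4-p-12 g3's split of K24b by file (bus
2026-08-29 02:23:39Z): F1 seat res-dim4-typ-1 g2; spec res-dim4-idea-4 g3 HANDOFF-g3 §11 ((VT) «vertex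
translation is zero in the normal form»).]  Nothing here proves K2(p)/K2(5), `NoIsolatedTrap 5 5` or resolution of
singularities in dimension ≥ 4 / characteristic `p` — NOT proved.  AI kernel work, weaker than expert review.

Setting (fixed coordinates, C∞ regime at `p = 5`): ledger `r = x_λ x_μ`, order `6`, and the STRAIGHT contact
presentation `in F = a · x^r · x_f⁴` (`a ≠ 0`).  A step in the boundary chart `λ` with translation vector `b`
(`b_λ = 0` chart letter, `b_μ = 0` kept weight) reads, at the degree-`2` exponent `x_λ x_μ` of the child,
the single number `a · b_f⁴` (§1 `coeff_pair_step_eq`: chart law at `x_λ⁵ x_μ`, Hauser's shear of the initial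
form, and `(x_f + b_f x_λ)⁴ ≡ b_f⁴ x_λ⁴ (mod x_f)`); so if the child again has order `6` (it stays in the
regime) then `b_f = 0` (§2 **`cInf_translation_contact_eq_zero`**) — the contact letter is NEVER translated
along the C∞ tail: the `f`-half of idea-4's (VT).  The `u`-half (`b_u = 0`, from the dead `ū²`-row, the
`u`-axis flag `V(0) ≠ 0`, the pair-ledger reading at `x_μ u⁴` and `3 ≠ 0`) is the next piece — hand
derivation in `pub/res-dim4/res-dim4-typ-1/HANDOFF.md` § «(VT) PINNING».
bears_on: LADDER-RESOLUTION:D157-DOOR2 (res-dim4-pi · K2(p) · slice B · K24b-FRAME F1 (VT-f)).  Supports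
stmt-ResolutionOfSingularities-16155 (helper).
-/

set_option linter.dupNamespace false -- mandated namespace of this single-conjunct summit

namespace Summit.ResolutionOfSingularities.ResolutionOfSingularities.Theorems.PIDim4

namespace ResCone

open MvPolynomial Finset
open Literature.AlgebraicGeometry.Resolution
open Literature.AlgebraicGeometry.Resolution.CentreBlowup
open Literature.AlgebraicGeometry.Resolution.Hauser2010
open Literature.AlgebraicGeometry.Resolution.HauserPerlega2019

variable {K : Type} [Field K] [DecidableEq K]

/-! ## 1. The reading at `x_λ x_μ` after a `λ`-step with translation `b` -/

omit [DecidableEq K] in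
/-- Hauser's shear of the straight initial monomial: `shear_λ^b (a·x_λ x_μ x_f⁴) = a·x_λ·x_μ·(x_f + b_f x_λ)⁴`
when `b_μ = 0`. [cite: Hauser2010, §I (definition of P⁺)] -/
theorem shear_monomial_pair_contact {lam mu f : Fin 4} (hml : mu ≠ lam) (hfl : f ≠ lam) {b : Fin 4 → K}
    (hbm : b mu = 0) (a : K) :
    shear lam b (monomial (Finsupp.single lam 1 + Finsupp.single mu 1 + Finsupp.single f 4) a) =
      C a * X lam * X mu * (X f + C (b f) * X lam) ^ 4 := by
  have hmon : (monomial (Finsupp.single lam 1 + Finsupp.single mu 1 + Finsupp.single f 4) a :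
      MvPolynomial (Fin 4) K) = C a * X lam * X mu * X f ^ 4 := by
    rw [X_pow_eq_monomial, X, X, C_mul_monomial, monomial_mul, monomial_mul, mul_one, mul_one, mul_one]
  rw [hmon]
  unfold shear
  rw [map_mul, map_mul, map_mul, map_pow, aeval_C, aeval_X, aeval_X, aeval_X, if_pos rfl, if_neg hml,
    if_neg hfl, hbm, C_0, zero_mul, add_zero, algebraMap_eq]

omit [DecidableEq K] in
/-- The `x_λ⁵ x_μ`-coefficient of `a·x_λ·x_μ·(x_f + γ x_λ)⁴` is `a γ⁴` (`(x_f + γx_λ)⁴ ≡ γ⁴x_λ⁴ (mod x_f)`).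
[folklore] -/
theorem coeff_pair_contact_shear {lam mu f : Fin 4} (hfl : f ≠ lam) (hfm : f ≠ mu) (a γ : K) :
    coeff (Finsupp.single lam 5 + Finsupp.single mu 1)
        (C a * X lam * X mu * (X f + C γ * X lam) ^ 4 : MvPolynomial (Fin 4) K) = a * γ ^ 4 := by
  obtain ⟨R, hR⟩ := sub_dvd_pow_sub_pow (X f + C γ * X lam : MvPolynomial (Fin 4) K) (C γ * X lam) 4
  rw [add_sub_cancel_right] at hR
  have hsplit : (C a * X lam * X mu * (X f + C γ * X lam) ^ 4 : MvPolynomial (Fin 4) K) =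
      monomial (Finsupp.single lam 5 + Finsupp.single mu 1) (a * γ ^ 4) + X f * (C a * X lam * X mu * R) := by
    have h4 : ((X f + C γ * X lam) ^ 4 : MvPolynomial (Fin 4) K) = (C γ * X lam) ^ 4 + X f * R := by
      rw [← hR]; ring
    have hm : (monomial (Finsupp.single lam 5 + Finsupp.single mu 1) (a * γ ^ 4) : MvPolynomial (Fin 4) K) =
        C (a * γ ^ 4) * (X lam ^ 5 * X mu) := by
      rw [X_pow_eq_monomial, X, monomial_mul, C_mul_monomial, mul_one, mul_one]
    rw [h4, hm, map_mul, map_pow]; ring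
  rw [hsplit, coeff_add, coeff_monomial, if_pos rfl, coeff_X_mul', if_neg, add_zero]
  rw [Finsupp.mem_support_iff, not_not, Finsupp.add_apply, Finsupp.single_apply, Finsupp.single_apply,
    if_neg hfl.symm, if_neg hfm.symm, zero_add]

/-- **The reading at `x_λ x_μ` of the child.**  For a state of order `6` with straight contact initial form
`in F = a·x^r x_f⁴`, `r = x_λ x_μ`, the step in chart `λ` with translations `b` (`b_λ = b_μ = 0`) has
`coeff_{x_λ x_μ} F′ = a · b_f⁴`. [OURS] [cite: Hauser2010, §§F, I] -/
theorem coeff_pair_step_eq {lam mu f : Fin 4} (hml : mu ≠ lam) (hfl : f ≠ lam) (hfm : f ≠ mu)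
    {s : State K} (ho : ordZero s.F = 6) {a : K}
    (hin : initialForm s.F = monomial (Finsupp.single lam 1 + Finsupp.single mu 1 + Finsupp.single f 4) a)
    {b : Fin 4 → K} (hbl : b lam = 0) (hbm : b mu = 0) :
    coeff (Finsupp.single lam 1 + Finsupp.single mu 1) (CentreBlowup.step 5 Finset.univ lam b s).F =
      a * b f ^ 4 := by
  have hq : ((5 : ℕ) : ℕ∞) ≤ ordAlong Finset.univ s.F := by
    rw [ordAlong_univ, ho]; exact_mod_cast (by norm_num : 5 ≤ 6)
  -- the chart preimage of `x_λ x_μ` is `x_λ⁵ x_μ`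
  have hdeg : (Finsupp.single lam 5 + Finsupp.single mu 1 : Fin 4 →₀ ℕ).degree = 6 := by
    simp only [map_add, Finsupp.degree_single]
  have he5 : (Finsupp.single lam 5 + Finsupp.single mu 1 : Fin 4 →₀ ℕ) lam = 5 := by
    simp [hml]
  have hce : chartExponent 5 Finset.univ lam (Finsupp.single lam 5 + Finsupp.single mu 1) =
      Finsupp.single lam 1 + Finsupp.single mu 1 := by
    apply Finsupp.ext
    intro i
    by_cases hi : i = lam
    · subst hi
      rw [chartExponent, degIn_univ, hdeg, Finsupp.coe_update, Function.update_self]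
      simp [hml]
    · rw [chartExponent_apply_of_ne 5 Finset.univ hi]
      simp [Finsupp.single_apply, Ne.symm hi]
  have hnp : ¬ IsPthPowerExponent 5 (chartExponent 5 Finset.univ lam
      (Finsupp.single lam 5 + Finsupp.single mu 1)) := by
    rw [hce]
    exact not_isPthPowerExponent_of_not_dvd (i := mu) (by simp [hml.symm])
  have h := coeff_step_F_chartExponent 5 lam hbl s hq (e := Finsupp.single lam 5 + Finsupp.single mu 1)
    (by rw [hdeg]; norm_num)
  rw [if_neg hnp, hce, coeff_shear_eq_coeff_shear_initialForm_of_degree_eq lam b ho hdeg, hin,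
    shear_monomial_pair_contact hml hfl hbm, coeff_pair_contact_shear hfl hfm] at h
  exact h

/-! ## 2. Pinning of the contact letter -/

/-- **C∞ PINNING, contact half** ((VT-f) of idea-4 §11): in the setting of `coeff_pair_step_eq` with `a ≠ 0`,
if the child again has order `6` then the contact letter was NOT translated: `b_f = 0` (otherwise the child
contains `a b_f⁴ · x_λ x_μ`, of degree `2 < 6`). [OURS] [cite: CossartJannsenSaito2020, Thm. 9.3 (setting)] -/
theorem cInf_translation_contact_eq_zero {lam mu f : Fin 4} (hml : mu ≠ lam) (hfl : f ≠ lam) (hfm : f ≠ mu)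
    {s : State K} (ho : ordZero s.F = 6) {a : K} (ha : a ≠ 0)
    (hin : initialForm s.F = monomial (Finsupp.single lam 1 + Finsupp.single mu 1 + Finsupp.single f 4) a)
    {b : Fin 4 → K} (hbl : b lam = 0) (hbm : b mu = 0)
    (ho' : ordZero (CentreBlowup.step 5 Finset.univ lam b s).F = 6) : b f = 0 := by
  have h := coeff_pair_step_eq hml hfl hfm ho hin hbl hbm
  have h0 : coeff (Finsupp.single lam 1 + Finsupp.single mu 1) (CentreBlowup.step 5 Finset.univ lam b s).F = 0 := by
    apply coeff_eq_zero_of_degree_lt_ordZero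
    rw [ho']
    simp only [map_add, Finsupp.degree_single]
    exact_mod_cast (by norm_num : (1 + 1 : ℕ) < 6)
  rw [h0] at h
  have h4 : b f ^ 4 = 0 := by
    rcases mul_eq_zero.mp h.symm with h1 | h1
    · exact absurd h1 ha
    · exact h1
  exact pow_eq_zero_iff (by norm_num) |>.mp h4

/-- The same with the child's order given as «at least `3`» — all that is used. [OURS] -/
theorem cInf_translation_contact_eq_zero_of_le {lam mu f : Fin 4} (hml : mu ≠ lam) (hfl : f ≠ lam)
    (hfm : f ≠ mu) {s : State K} (ho : ordZero s.F = 6) {a : K} (ha : a ≠ 0)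
    (hin : initialForm s.F = monomial (Finsupp.single lam 1 + Finsupp.single mu 1 + Finsupp.single f 4) a)
    {b : Fin 4 → K} (hbl : b lam = 0) (hbm : b mu = 0)
    (ho' : ((3 : ℕ) : ℕ∞) ≤ ordZero (CentreBlowup.step 5 Finset.univ lam b s).F) : b f = 0 := by
  have h := coeff_pair_step_eq hml hfl hfm ho hin hbl hbm
  have h0 : coeff (Finsupp.single lam 1 + Finsupp.single mu 1) (CentreBlowup.step 5 Finset.univ lam b s).F = 0 := by
    apply coeff_eq_zero_of_degree_lt_ordZero
    refine lt_of_lt_of_le ?_ ho'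
    simp only [map_add, Finsupp.degree_single]
    exact_mod_cast (by norm_num : (1 + 1 : ℕ) < 3)
  rw [h0] at h
  have h4 : b f ^ 4 = 0 := by
    rcases mul_eq_zero.mp h.symm with h1 | h1
    · exact absurd h1 ha
    · exact h1
  exact pow_eq_zero_iff (by norm_num) |>.mp h4

end ResCone

end Summit.ResolutionOfSingularities.ResolutionOfSingularities.Theorems.PIDim4
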